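import Summits.SmoothPoincare4.SmoothPoincare4.Theorems.DottedCircleRasmussenDcrGapHelperHandlebodyChartModelHandlesDataPart1
import Summits.SmoothPoincare4.SmoothPoincare4.Theorems.DottedCircleRasmussenDcrGapHelperHandlebodyChartModelHandlesDataPart2
import Summits.SmoothPoincare4.SmoothPoincare4.Theorems.DottedCircleRasmussenDcrGapHelperHandlebodyChartModelHandlesPhase
import Summits.SmoothPoincare4.SmoothPoincare4.Theorems.DottedCircleRasmussenDcrGapHelperHandlebodyChartModelHandlesOfData
import Summits.SmoothPoincare4.SmoothPoincare4.Theorems.DottedCircleRasmussenDcrGapStubHandlebodyChartReduction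
import Literature.Topology.FourManifolds.OneHandleUniquenessProofs

/-!
# Stub D `stub_handlebodyChart` of line `mk_friends` for crux `DcrGap` — PROVED
(item stmt-SmoothPoincare4-16128, route route-SmoothPoincare4-DottedCircleRasmussen)

**Handlebody germ charts are standard up to sector.**  In a compact simply connected smooth `4`-manifold `X`,
every germ chart `i` of the model dotted handlebody `D_k = MMSW.modelHandlebody k` (a smooth injective
immersion of an open `U ⊇ D_k`) extends, after precomposition with a product of per-handle sphere twists
`τ^ε = fibreRot (Π_j u(z - c_j)^{ε_j})`, to a GLOBAL smooth embedding `e : ℝ⁴ → X` with `e ∘ τ^ε = i` on `D_k`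
(registered stub `stub_handlebodyChart` of the line's skeleton, `Cruxes/DcrGap/Lines/mk_friends.lean`).

This file only ASSEMBLES landed work:

* `helper_handlebodyChart_modelHandles_data_of_parts` / `helper_handlebodyChart_modelHandles_data` — the explicit
  handle data of `D_k` (registered stub, skeleton v7) from its three landed parts
  `helper_handlebodyChart_modelHandles_data_part1` (explicit equivariant handle charts with angle lifts, covering
  the arches; `…ModelHandlesDataPart1.lean`), `…_part2` (equivariant compactly supported squeeze of `D_k` into
  ball ∪ arches with swept-angle lifts; `…ModelHandlesDataPart2.lean`) and
  `helper_handlebodyChart_modelHandles_phaseOfLifts` (phase data from the lifts; `…ModelHandlesPhase.lean`);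
* `helper_handlebodyChart_modelHandles` — M3, the handle structure of `D_k` (registered helper stub), by the landed
  reduction `helper_handlebodyChart_modelHandles_of_data` (`…ModelHandlesOfData.lean`);
* `stub_handlebodyChart` — stub D, by the landed reduction `helper_handlebodyChart_of_facts2`
  (`…StubHandlebodyChartReduction.lean`) fed with the discharged Literature facts M1
  `oneHandle_ambientIsotopic_upToTwist_holds` (uniqueness of `1`-handles up to the fibre twist) and M2
  `arcs_ambientIsotopic_rel_of_homotopicRel_holds` (homotopic arcs are ambient isotopic rel ends in dimension `4`)
  of `Literature/Topology/FourManifolds/OneHandleUniquenessProofs.lean`, and M3.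

No definitions, no named facts, no `sorry`.

## References

* R. E. Gompf, A. I. Stipsicz, *4-Manifolds and Kirby Calculus*, GSM 20 (1999), §4.1, §4.4, §5.4. [GompfStipsicz1999]
* M. W. Hirsch, *Differential Topology*, GTM 33 (1976), Ch. 4 §5 Thm. 5.3, Ch. 8 §1 Thm. 1.3. [HirschDT1976]
* R. S. Palais, *Extending diffeomorphisms*, Proc. AMS 11 (1960), Thm. B. [Palais1960]
-/

-- the prescribed namespace `Summit.<P>.<Sub>.…` duplicates `SmoothPoincare4` (P = Sub)
set_option linter.dupNamespace false
set_option linter.style.longLine false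
noncomputable section

open scoped Manifold ContDiff Topology
open Function Set Metric Filter
open Literature.Topology.FourManifolds Literature.Topology.FourManifolds.MMSW
open Literature.AlgebraicTopology.Homotopy.HopfFibration

namespace Summit.SmoothPoincare4.SmoothPoincare4.Theorems.DcrGap.MkFriends

/-- **Assembly of the explicit handle data of `D_k` from its three parts** (explicit charts with lifts and cover of the arches; equivariant squeeze into ball ∪ arches; phase data from the lifts): the cover clause turns "`κ x` lies in an arch `A_j`" into "`κ x = h j p` for some `p` in the solid cylinder". [cite: GompfStipsicz1999, §4.1 and §4.4] -/
theorem helper_handlebodyChart_modelHandles_data_of_parts : (∀ (k : ℕ), ∃ (c : EuclideanSpace ℝ (Fin 4)) (a : ℝ) (W : Set (EuclideanSpace ℝ (Fin 4))) (h : Fin k → EuclideanSpace ℝ (Fin 4) → EuclideanSpace ℝ (Fin 4)), c = Literature.AlgebraicTopology.Homotopy.HopfFibration.ofZW (Complex.mk 0 (-(20 * (k : ℝ)))) 0 ∧ a = 2 / 15 ∧ (0 < a ∧ Metric.closedBall c (3 * a / 2) ⊆ Literature.Topology.FourManifolds.MMSW.modelHandlebody k ∧ IsOpen W ∧ {p :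 EuclideanSpace ℝ (Fin 4) | |p 0| ≤ 1 ∧ (p 1) ^ 2 + (p 2) ^ 2 + (p 3) ^ 2 ≤ 1} ⊆ W ∧ (∀ j, ContDiffOn ℝ ((⊤ : ℕ∞) : WithTop ℕ∞) (h j) W ∧ Set.InjOn (h j) W ∧ (∀ p ∈ W, Function.Injective (fderiv ℝ (h j) p)) ∧ Set.MapsTo (h j) W (Literature.Topology.FourManifolds.MMSW.modelHandlebody k)) ∧ (∀ j l, j ≠ l → ∀ p ∈ W, ∀ q ∈ W, h j p ≠ h l q) ∧ (∀ j, ∀ p ∈ W, 1 / 2 ≤ |p 0| → dist (h j p) c = a * (2 - |p 0|)) ∧ (∀ j, ∀ p ∈ W, |p 0| ≤ 1 / 2 → 3 * a / 2 ≤ dist (h j p) c)) ∧ (∀ j (β : ℝ), ∀ p ∈ W, h j (!₂[p 0, p 1, Real.cos β * p 2 - Real.sin β * p 3, Real.sin β * p 2 + Real.cos β * p 3]) = Literature.Topology.FourManifolds.MMSW.fibreRot (fun _ => Complex.exp ((β : ℂ) * Complex.I)) (h j p)) ∧ (∀ j l, ∃ Λ : EuclideanSpace ℝ (Fin 4) →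 ℝ, ContDiffOn ℝ ((⊤ : ℕ∞) : WithTop ℕ∞) Λ W ∧ (∀ p ∈ W, Complex.exp ((Λ p : ℂ) * Complex.I) = (Literature.AlgebraicTopology.Homotopy.HopfFibration.zC (h j p) - Literature.Topology.FourManifolds.MMSW.holeCentre k l) / (((‖Literature.AlgebraicTopology.Homotopy.HopfFibration.zC (h j p) - Literature.Topology.FourManifolds.MMSW.holeCentre k l‖ : ℝ)) : ℂ)) ∧ (∀ (β : ℝ), ∀ p ∈ W, !₂[p 0, p 1, Real.cos β * p 2 - Real.sin β * p 3, Real.sin β * p 2 + Real.cos β * p 3] ∈ W → Λ (!₂[p 0, p 1, Real.cos β * p 2 - Real.sin β * p 3, Real.sin β * p 2 + Real.cos β * p 3]) = Λ p) ∧ (∀ p ∈ W, 1 / 2 ≤ |p 0| → Λ p = Complex.arg ((Literature.AlgebraicTopology.Homotopy.HopfFibration.zC (h j p) - Literature.Topology.FourManifolds.MMSW.holeCentre k l) * (starRingEnd ℂ) (Literature.AlgebraicTopology.Homotopy.HopfFibration.zC c - Literature.Topology.FourManifolds.MMSW.holeCentre k l)) + Complex.arg (Literature.AlgebraicTopology.Homotopy.HopfFibration.zC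 c - Literature.Topology.FourManifolds.MMSW.holeCentre k l) + (if j = l ∧ 0 < p 0 then 2 * Real.pi else 0))) ∧ (∀ j (y : EuclideanSpace ℝ (Fin 4)) (q v : ℂ), q = Literature.AlgebraicTopology.Homotopy.HopfFibration.zC y - Complex.mk 0 (-(20 * (k : ℝ))) → v = Literature.Topology.FourManifolds.MMSW.holeCentre k j - Complex.mk 0 (-(20 * (k : ℝ))) → ‖Literature.AlgebraicTopology.Homotopy.HopfFibration.wC y‖ ≤ 1 / (2000 * ((k : ℝ) + 1)) ∧ ((8 / 5 ≤ ‖q - v‖ ∧ ‖q - v‖ ≤ 41 / 25 ∧ -(7 / 10) * ‖v‖ ≤ ((q - v) * (starRingEnd ℂ) v).re) ∨ (2 / 15 ≤ ‖q‖ ∧ ‖q‖ ≤ ‖v‖ + 1 / 2 ∧ 0 < (q * (starRingEnd ℂ) v).re ∧ 8 / 5 * ‖q‖ ≤ |(q * (starRingEnd ℂ) v).im| ∧ |(q * (starRingEnd ℂ) v).im| ≤ 41 / 25 * ‖q‖)) → ∃ p ∈ {p : EuclideanSpace ℝ (Fin 4) | |p 0| ≤ 1 ∧ (p 1) ^ 2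 + (p 2) ^ 2 + (p 3) ^ 2 ≤ 1}, h j p = y)) → (∀ (k : ℕ) (U : Set (EuclideanSpace ℝ (Fin 4))) (ρ : ℝ), IsOpen U → Literature.Topology.FourManifolds.MMSW.modelHandlebody k ⊆ U → 2 / 15 < ρ → ρ < 1 / 5 → ∃ (κ : EuclideanSpace ℝ (Fin 4) ≃ₘ⟮𝓡 4, 𝓡 4⟯ EuclideanSpace ℝ (Fin 4)) (K N₀ : Set (EuclideanSpace ℝ (Fin 4))) (SW : Fin k → EuclideanSpace ℝ (Fin 4) → ℝ), IsCompact K ∧ K ⊆ U ∧ (∀ x, x ∉ K → κ x = x) ∧ (∀ v : ℂ, ‖v‖ = 1 → ∀ x, κ (Literature.Topology.FourManifolds.MMSW.fibreRot (fun _ => v) x) = Literature.Topology.FourManifolds.MMSW.fibreRot (fun _ => v) (κ x)) ∧ (∀ x ∈ Literature.Topology.FourManifolds.MMSW.modelHandlebody k, κ x ∈ Metric.closedBall (Literature.AlgebraicTopology.Homotopy.HopfFibration.ofZW (Complex.mk 0 (-(20 * (k : ℝ)))) 0) ρ ∨ ∃ j, ∀ (q v : ℂ), q = Literature.AlgebraicTopology.Homotopy.HopfFibration.zC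 (κ x) - Complex.mk 0 (-(20 * (k : ℝ))) → v = Literature.Topology.FourManifolds.MMSW.holeCentre k j - Complex.mk 0 (-(20 * (k : ℝ))) → ‖Literature.AlgebraicTopology.Homotopy.HopfFibration.wC (κ x)‖ ≤ 1 / (2000 * ((k : ℝ) + 1)) ∧ ((8 / 5 ≤ ‖q - v‖ ∧ ‖q - v‖ ≤ 41 / 25 ∧ -(7 / 10) * ‖v‖ ≤ ((q - v) * (starRingEnd ℂ) v).re) ∨ (2 / 15 ≤ ‖q‖ ∧ ‖q‖ ≤ ‖v‖ + 1 / 2 ∧ 0 < (q * (starRingEnd ℂ) v).re ∧ 8 / 5 * ‖q‖ ≤ |(q * (starRingEnd ℂ) v).im| ∧ |(q * (starRingEnd ℂ) v).im| ≤ 41 / 25 * ‖q‖))) ∧ IsOpen N₀ ∧ Literature.Topology.FourManifolds.MMSW.modelHandlebody k ⊆ N₀ ∧ (∀ l, ContDiffOn ℝ ((⊤ : ℕ∞) : WithTop ℕ∞) (SW l) N₀) ∧ (∀ l (v : ℂ), ‖v‖ = 1 → ∀ x, SW l (Literature.Topology.FourManifolds.MMSW.fibreRot (fun _ => v) x) =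 SW l x) ∧ ∀ l, ∀ x ∈ Literature.Topology.FourManifolds.MMSW.modelHandlebody k, (Literature.AlgebraicTopology.Homotopy.HopfFibration.zC (κ x) - Literature.Topology.FourManifolds.MMSW.holeCentre k l) / ((‖Literature.AlgebraicTopology.Homotopy.HopfFibration.zC (κ x) - Literature.Topology.FourManifolds.MMSW.holeCentre k l‖ : ℝ) : ℂ) = Complex.exp ((SW l x : ℂ) * Complex.I) * ((Literature.AlgebraicTopology.Homotopy.HopfFibration.zC x - Literature.Topology.FourManifolds.MMSW.holeCentre k l) / ((‖Literature.AlgebraicTopology.Homotopy.HopfFibration.zC x - Literature.Topology.FourManifolds.MMSW.holeCentre k l‖ : ℝ) : ℂ))) → (∀ (k : ℕ) (c : EuclideanSpace ℝ (Fin 4)) (a : ℝ) (W : Set (EuclideanSpace ℝ (Fin 4))) (h : Fin k → EuclideanSpace ℝ (Fin 4) → EuclideanSpace ℝ (Fin 4)), (0 < a ∧ Metric.closedBall c (3 * a / 2) ⊆ Literature.Topology.FourManifolds.MMSW.modelHandlebody k ∧ IsOpen W ∧ {p : EuclideanSpace ℝ (Fin 4) | |p 0| ≤ 1 ∧ (p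 1) ^ 2 + (p 2) ^ 2 + (p 3) ^ 2 ≤ 1} ⊆ W ∧ (∀ j, ContDiffOn ℝ ((⊤ : ℕ∞) : WithTop ℕ∞) (h j) W ∧ Set.InjOn (h j) W ∧ (∀ p ∈ W, Function.Injective (fderiv ℝ (h j) p)) ∧ Set.MapsTo (h j) W (Literature.Topology.FourManifolds.MMSW.modelHandlebody k)) ∧ (∀ j l, j ≠ l → ∀ p ∈ W, ∀ q ∈ W, h j p ≠ h l q) ∧ (∀ j, ∀ p ∈ W, 1 / 2 ≤ |p 0| → dist (h j p) c = a * (2 - |p 0|)) ∧ (∀ j, ∀ p ∈ W, |p 0| ≤ 1 / 2 → 3 * a / 2 ≤ dist (h j p) c)) → (∀ j (β : ℝ), ∀ p ∈ W, h j (!₂[p 0, p 1, Real.cos β * p 2 - Real.sin β * p 3, Real.sin β * p 2 + Real.cos β * p 3]) = Literature.Topology.FourManifolds.MMSW.fibreRot (fun _ => Complex.exp ((β : ℂ) * Complex.I)) (h j p)) → (∀ j l, ∃ Λ : EuclideanSpace ℝ (Fin 4) → ℝ, ContDiffOn ℝ ((⊤ : ℕ∞) : WithTop ℕ∞) Λ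 W ∧ (∀ p ∈ W, Complex.exp ((Λ p : ℂ) * Complex.I) = (Literature.AlgebraicTopology.Homotopy.HopfFibration.zC (h j p) - Literature.Topology.FourManifolds.MMSW.holeCentre k l) / (((‖Literature.AlgebraicTopology.Homotopy.HopfFibration.zC (h j p) - Literature.Topology.FourManifolds.MMSW.holeCentre k l‖ : ℝ)) : ℂ)) ∧ (∀ (β : ℝ), ∀ p ∈ W, !₂[p 0, p 1, Real.cos β * p 2 - Real.sin β * p 3, Real.sin β * p 2 + Real.cos β * p 3] ∈ W → Λ (!₂[p 0, p 1, Real.cos β * p 2 - Real.sin β * p 3, Real.sin β * p 2 + Real.cos β * p 3]) = Λ p) ∧ (∀ p ∈ W, 1 / 2 ≤ |p 0| → Λ p = Complex.arg ((Literature.AlgebraicTopology.Homotopy.HopfFibration.zC (h j p) - Literature.Topology.FourManifolds.MMSW.holeCentre k l) * (starRingEnd ℂ) (Literature.AlgebraicTopology.Homotopy.HopfFibration.zC c - Literature.Topology.FourManifolds.MMSW.holeCentre k l)) + Complex.arg (Literature.AlgebraicTopology.Homotopy.HopfFibration.zC c - Literature.Topology.FourManifolds.MMSW.holeCentre k l)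 + (if j = l ∧ 0 < p 0 then 2 * Real.pi else 0))) → (∀ (m : Fin k → ℤ) (ρ : ℝ), ρ < 3 * a / 2 → ∃ (ε : Fin k → ℤ) (N' : Set (EuclideanSpace ℝ (Fin 4))) (Θ : EuclideanSpace ℝ (Fin 4) → ℝ), IsOpen N' ∧ Metric.closedBall c ρ ⊆ N' ∧ (∀ j, h j '' {p : EuclideanSpace ℝ (Fin 4) | |p 0| ≤ 1 ∧ (p 1) ^ 2 + (p 2) ^ 2 + (p 3) ^ 2 ≤ 1} ⊆ N') ∧ ContDiffOn ℝ ((⊤ : ℕ∞) : WithTop ℕ∞) Θ N' ∧ (∀ v : ℂ, ‖v‖ = 1 → ∀ y ∈ N', Θ (Literature.Topology.FourManifolds.MMSW.fibreRot (fun _ => v) y) = Θ y) ∧ (∀ y ∈ N', dist y c ≤ ρ → Complex.exp ((Θ y : ℂ) * Complex.I) * ∏ l : Fin k, ((Literature.AlgebraicTopology.Homotopy.HopfFibration.zC y - Literature.Topology.FourManifolds.MMSW.holeCentre k l) / (((‖Literature.AlgebraicTopology.Homotopy.HopfFibration.zC y - Literature.Topology.FourManifolds.MMSW.holeCentre k l‖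 : ℝ)) : ℂ)) ^ (ε l) = 1) ∧ (∀ j, ∀ p ∈ W, h j p ∈ N' → Complex.exp ((Θ (h j p) : ℂ) * Complex.I) * ∏ l : Fin k, ((Literature.AlgebraicTopology.Homotopy.HopfFibration.zC (h j p) - Literature.Topology.FourManifolds.MMSW.holeCentre k l) / (((‖Literature.AlgebraicTopology.Homotopy.HopfFibration.zC (h j p) - Literature.Topology.FourManifolds.MMSW.holeCentre k l‖ : ℝ)) : ℂ)) ^ (ε l) = Complex.exp (((2 * Real.pi * (m j : ℝ) * Real.smoothTransition (p 0 + 1 / 2) : ℝ) : ℂ) * Complex.I)))) → ∀ (k : ℕ), ∃ (c : EuclideanSpace ℝ (Fin 4)) (a : ℝ) (W : Set (EuclideanSpace ℝ (Fin 4))) (h : Fin k → EuclideanSpace ℝ (Fin 4) → EuclideanSpace ℝ (Fin 4)), (0 < a ∧ Metric.closedBall c (3 * a / 2) ⊆ Literature.Topology.FourManifolds.MMSW.modelHandlebody k ∧ IsOpen W ∧ {p : EuclideanSpace ℝ (Fin 4) | |p 0| ≤ 1 ∧ (p 1) ^ 2 + (p 2) ^ 2 + (p 3) ^ 2 ≤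 1} ⊆ W ∧ (∀ j, ContDiffOn ℝ ((⊤ : ℕ∞) : WithTop ℕ∞) (h j) W ∧ Set.InjOn (h j) W ∧ (∀ p ∈ W, Function.Injective (fderiv ℝ (h j) p)) ∧ Set.MapsTo (h j) W (Literature.Topology.FourManifolds.MMSW.modelHandlebody k)) ∧ (∀ j l, j ≠ l → ∀ p ∈ W, ∀ q ∈ W, h j p ≠ h l q) ∧ (∀ j, ∀ p ∈ W, 1 / 2 ≤ |p 0| → dist (h j p) c = a * (2 - |p 0|)) ∧ (∀ j, ∀ p ∈ W, |p 0| ≤ 1 / 2 → 3 * a / 2 ≤ dist (h j p) c)) ∧ (∀ j (β : ℝ), ∀ p ∈ W, h j (!₂[p 0, p 1, Real.cos β * p 2 - Real.sin β * p 3, Real.sin β * p 2 + Real.cos β * p 3]) = Literature.Topology.FourManifolds.MMSW.fibreRot (fun _ => Complex.exp ((β : ℂ) * Complex.I)) (h j p)) ∧ (∀ (m : Fin k → ℤ) (ρ : ℝ), ρ < 3 * a / 2 → ∃ (ε : Fin k → ℤ) (N' : Set (EuclideanSpace ℝ (Fin 4))) (Θ : EuclideanSpace ℝ (Fin 4) →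 ℝ), IsOpen N' ∧ Metric.closedBall c ρ ⊆ N' ∧ (∀ j, h j '' {p : EuclideanSpace ℝ (Fin 4) | |p 0| ≤ 1 ∧ (p 1) ^ 2 + (p 2) ^ 2 + (p 3) ^ 2 ≤ 1} ⊆ N') ∧ ContDiffOn ℝ ((⊤ : ℕ∞) : WithTop ℕ∞) Θ N' ∧ (∀ v : ℂ, ‖v‖ = 1 → ∀ y ∈ N', Θ (Literature.Topology.FourManifolds.MMSW.fibreRot (fun _ => v) y) = Θ y) ∧ (∀ y ∈ N', dist y c ≤ ρ → Complex.exp ((Θ y : ℂ) * Complex.I) * ∏ l : Fin k, ((Literature.AlgebraicTopology.Homotopy.HopfFibration.zC y - Literature.Topology.FourManifolds.MMSW.holeCentre k l) / (((‖Literature.AlgebraicTopology.Homotopy.HopfFibration.zC y - Literature.Topology.FourManifolds.MMSW.holeCentre k l‖ : ℝ)) : ℂ)) ^ (ε l) = 1) ∧ (∀ j, ∀ p ∈ W, h j p ∈ N' → Complex.exp ((Θ (h j p) : ℂ) * Complex.I) * ∏ l : Fin k, ((Literature.AlgebraicTopology.Homotopy.HopfFibration.zC (h j p) - Literature.Topology.FourManifolds.MMSW.holeCentre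 k l) / (((‖Literature.AlgebraicTopology.Homotopy.HopfFibration.zC (h j p) - Literature.Topology.FourManifolds.MMSW.holeCentre k l‖ : ℝ)) : ℂ)) ^ (ε l) = Complex.exp (((2 * Real.pi * (m j : ℝ) * Real.smoothTransition (p 0 + 1 / 2) : ℝ) : ℂ) * Complex.I))) ∧ (∀ (U : Set (EuclideanSpace ℝ (Fin 4))) (ρ : ℝ), IsOpen U → Literature.Topology.FourManifolds.MMSW.modelHandlebody k ⊆ U → a < ρ → ρ < 3 * a / 2 → ∃ (κ : EuclideanSpace ℝ (Fin 4) ≃ₘ⟮𝓡 4, 𝓡 4⟯ EuclideanSpace ℝ (Fin 4)) (K N₀ : Set (EuclideanSpace ℝ (Fin 4))) (SW : Fin k → EuclideanSpace ℝ (Fin 4) → ℝ), IsCompact K ∧ K ⊆ U ∧ (∀ x, x ∉ K → κ x = x) ∧ (∀ v : ℂ, ‖v‖ = 1 → ∀ x, κ (Literature.Topology.FourManifolds.MMSW.fibreRot (fun _ => v) x) = Literature.Topology.FourManifolds.MMSW.fibreRot (fun _ => v) (κ x)) ∧ (∀ x ∈ Literature.Topology.FourManifolds.MMSW.modelHandlebody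 k, κ x ∈ Metric.closedBall c ρ ∨ ∃ j, ∃ p ∈ {p : EuclideanSpace ℝ (Fin 4) | |p 0| ≤ 1 ∧ (p 1) ^ 2 + (p 2) ^ 2 + (p 3) ^ 2 ≤ 1}, κ x = h j p) ∧ IsOpen N₀ ∧ Literature.Topology.FourManifolds.MMSW.modelHandlebody k ⊆ N₀ ∧ (∀ l, ContDiffOn ℝ ((⊤ : ℕ∞) : WithTop ℕ∞) (SW l) N₀) ∧ (∀ l (v : ℂ), ‖v‖ = 1 → ∀ x, SW l (Literature.Topology.FourManifolds.MMSW.fibreRot (fun _ => v) x) = SW l x) ∧ ∀ l, ∀ x ∈ Literature.Topology.FourManifolds.MMSW.modelHandlebody k, (Literature.AlgebraicTopology.Homotopy.HopfFibration.zC (κ x) - Literature.Topology.FourManifolds.MMSW.holeCentre k l) / ((‖Literature.AlgebraicTopology.Homotopy.HopfFibration.zC (κ x) - Literature.Topology.FourManifolds.MMSW.holeCentre k l‖ : ℝ) : ℂ) = Complex.exp ((SW l x : ℂ) * Complex.I) * ((Literature.AlgebraicTopology.Homotopy.HopfFibration.zC x - Literature.Topology.FourManifolds.MMSW.holeCentre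 k l) / ((‖Literature.AlgebraicTopology.Homotopy.HopfFibration.zC x - Literature.Topology.FourManifolds.MMSW.holeCentre k l‖ : ℝ) : ℂ))) := by
  intro h1 h2 h3 k
  obtain ⟨c, a, W, h, hc, ha, hstatic, hequiv, hlift, hcover⟩ := h1 k
  refine ⟨c, a, W, h, hstatic, hequiv, h3 k c a W h hstatic hequiv hlift, ?_⟩
  intro U ρ hUo hDU haρ hρ
  subst hc ha
  obtain ⟨κ, K, N₀, SW, hKc, hKU, hκK, hκrot, himg, hrest⟩ :=
    h2 k U ρ hUo hDU (by linarith) (by linarith)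
  refine ⟨κ, K, N₀, SW, hKc, hKU, hκK, hκrot, fun x hx => ?_, hrest⟩
  rcases himg x hx with hb | ⟨j, hj⟩
  · exact Or.inl hb
  · obtain ⟨p, hp, hpy⟩ := hcover j (κ x) _ _ rfl rfl (hj _ _ rfl rfl)
    exact Or.inr ⟨j, p, hp, hpy.symm⟩


/-- **The explicit handle data of the model dotted handlebody `D_k`** (registered stub
`helper_handlebodyChart_modelHandles_data` of line `mk_friends`, skeleton v7): base ball, `k` equivariant handle
charts entering the ball radially, phase data for every twist vector, and for every open `U ⊇ D_k` an equivariant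
squeeze of `D_k` into ball ∪ handles supported in `U` with swept-angle lifts — from the three landed parts.
[cite: GompfStipsicz1999, §4.1 and §4.4] -/
theorem helper_handlebodyChart_modelHandles_data : ∀ (k : ℕ), ∃ (c : EuclideanSpace ℝ (Fin 4)) (a : ℝ) (W : Set (EuclideanSpace ℝ (Fin 4))) (h : Fin k → EuclideanSpace ℝ (Fin 4) → EuclideanSpace ℝ (Fin 4)), (0 < a ∧ Metric.closedBall c (3 * a / 2) ⊆ Literature.Topology.FourManifolds.MMSW.modelHandlebody k ∧ IsOpen W ∧ {p : EuclideanSpace ℝ (Fin 4) | |p 0| ≤ 1 ∧ (p 1) ^ 2 + (p 2) ^ 2 + (p 3) ^ 2 ≤ 1} ⊆ W ∧ (∀ j, ContDiffOn ℝ ((⊤ : ℕ∞) : WithTop ℕ∞) (h j) W ∧ Set.InjOn (h j) W ∧ (∀ p ∈ W, Function.Injective (fderiv ℝ (h j) p)) ∧ Set.MapsTo (h j) W (Literature.Topology.FourManifolds.MMSW.modelHandlebody k)) ∧ (∀ j l, j ≠ l → ∀ p ∈ W, ∀ q ∈ W, h j p ≠ h l q) ∧ (∀ j, ∀ p ∈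 W, 1 / 2 ≤ |p 0| → dist (h j p) c = a * (2 - |p 0|)) ∧ (∀ j, ∀ p ∈ W, |p 0| ≤ 1 / 2 → 3 * a / 2 ≤ dist (h j p) c)) ∧ (∀ j (β : ℝ), ∀ p ∈ W, h j (!₂[p 0, p 1, Real.cos β * p 2 - Real.sin β * p 3, Real.sin β * p 2 + Real.cos β * p 3]) = Literature.Topology.FourManifolds.MMSW.fibreRot (fun _ => Complex.exp ((β : ℂ) * Complex.I)) (h j p)) ∧ (∀ (m : Fin k → ℤ) (ρ : ℝ), ρ < 3 * a / 2 → ∃ (ε : Fin k → ℤ) (N' : Set (EuclideanSpace ℝ (Fin 4))) (Θ : EuclideanSpace ℝ (Fin 4) → ℝ), IsOpen N' ∧ Metric.closedBall c ρ ⊆ N' ∧ (∀ j, h j '' {p : EuclideanSpace ℝ (Fin 4) | |p 0| ≤ 1 ∧ (p 1) ^ 2 + (p 2) ^ 2 + (p 3) ^ 2 ≤ 1} ⊆ N') ∧ ContDiffOn ℝ ((⊤ : ℕ∞) : WithTop ℕ∞) Θ N' ∧ (∀ v : ℂ, ‖v‖ = 1 → ∀ y ∈ N', Θ (Literature.Topology.FourManifolds.MMSW.fibreRot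 (fun _ => v) y) = Θ y) ∧ (∀ y ∈ N', dist y c ≤ ρ → Complex.exp ((Θ y : ℂ) * Complex.I) * ∏ l : Fin k, ((Literature.AlgebraicTopology.Homotopy.HopfFibration.zC y - Literature.Topology.FourManifolds.MMSW.holeCentre k l) / (((‖Literature.AlgebraicTopology.Homotopy.HopfFibration.zC y - Literature.Topology.FourManifolds.MMSW.holeCentre k l‖ : ℝ)) : ℂ)) ^ (ε l) = 1) ∧ (∀ j, ∀ p ∈ W, h j p ∈ N' → Complex.exp ((Θ (h j p) : ℂ) * Complex.I) * ∏ l : Fin k, ((Literature.AlgebraicTopology.Homotopy.HopfFibration.zC (h j p) - Literature.Topology.FourManifolds.MMSW.holeCentre k l) / (((‖Literature.AlgebraicTopology.Homotopy.HopfFibration.zC (h j p) - Literature.Topology.FourManifolds.MMSW.holeCentre k l‖ : ℝ)) : ℂ)) ^ (ε l) = Complex.exp (((2 * Real.pi * (m j : ℝ) * Real.smoothTransition (p 0 + 1 / 2) : ℝ) : ℂ) * Complex.I))) ∧ (∀ (U : Set (EuclideanSpace ℝ (Fin 4))) (ρ : ℝ), IsOpen U → Literature.Topology.FourManifolds.MMSW.modelHandlebody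 k ⊆ U → a < ρ → ρ < 3 * a / 2 → ∃ (κ : EuclideanSpace ℝ (Fin 4) ≃ₘ⟮𝓡 4, 𝓡 4⟯ EuclideanSpace ℝ (Fin 4)) (K N₀ : Set (EuclideanSpace ℝ (Fin 4))) (SW : Fin k → EuclideanSpace ℝ (Fin 4) → ℝ), IsCompact K ∧ K ⊆ U ∧ (∀ x, x ∉ K → κ x = x) ∧ (∀ v : ℂ, ‖v‖ = 1 → ∀ x, κ (Literature.Topology.FourManifolds.MMSW.fibreRot (fun _ => v) x) = Literature.Topology.FourManifolds.MMSW.fibreRot (fun _ => v) (κ x)) ∧ (∀ x ∈ Literature.Topology.FourManifolds.MMSW.modelHandlebody k, κ x ∈ Metric.closedBall c ρ ∨ ∃ j, ∃ p ∈ {p : EuclideanSpace ℝ (Fin 4) | |p 0| ≤ 1 ∧ (p 1) ^ 2 + (p 2) ^ 2 + (p 3) ^ 2 ≤ 1}, κ x = h j p) ∧ IsOpen N₀ ∧ Literature.Topology.FourManifolds.MMSW.modelHandlebody k ⊆ N₀ ∧ (∀ l, ContDiffOn ℝ ((⊤ : ℕ∞) : WithTop ℕ∞) (SW l) N₀) ∧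 (∀ l (v : ℂ), ‖v‖ = 1 → ∀ x, SW l (Literature.Topology.FourManifolds.MMSW.fibreRot (fun _ => v) x) = SW l x) ∧ ∀ l, ∀ x ∈ Literature.Topology.FourManifolds.MMSW.modelHandlebody k, (Literature.AlgebraicTopology.Homotopy.HopfFibration.zC (κ x) - Literature.Topology.FourManifolds.MMSW.holeCentre k l) / ((‖Literature.AlgebraicTopology.Homotopy.HopfFibration.zC (κ x) - Literature.Topology.FourManifolds.MMSW.holeCentre k l‖ : ℝ) : ℂ) = Complex.exp ((SW l x : ℂ) * Complex.I) * ((Literature.AlgebraicTopology.Homotopy.HopfFibration.zC x - Literature.Topology.FourManifolds.MMSW.holeCentre k l) / ((‖Literature.AlgebraicTopology.Homotopy.HopfFibration.zC x - Literature.Topology.FourManifolds.MMSW.holeCentre k l‖ : ℝ) : ℂ))) :=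
  helper_handlebodyChart_modelHandles_data_of_parts helper_handlebodyChart_modelHandles_data_part1
    helper_handlebodyChart_modelHandles_data_part2 helper_handlebodyChart_modelHandles_phaseOfLifts

/-- **M3 — the handle structure of the model dotted handlebody `D_k`** (registered helper stub
`helper_handlebodyChart_modelHandles` of line `mk_friends`): base ball, `k` handle charts, and for every open
`U ⊇ D_k`, twist vector `m` and radius `a < ρ < 3a/2` a twist exponent `ε`, a diffeomorphism `κ` of `ℝ⁴`
supported in `U` squeezing `D_k` into ball ∪ handles, and a global smooth injective immersion `θ` with
`θ ∘ τ^ε = σ_m ∘ κ` on `D_k` — by the landed `helper_handlebodyChart_modelHandles_of_data` applied to the data.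
[cite: GompfStipsicz1999, §4.4] -/
theorem helper_handlebodyChart_modelHandles : ∀ (k : ℕ), ∃ (c : EuclideanSpace ℝ (Fin 4)) (a : ℝ) (W : Set (EuclideanSpace ℝ (Fin 4))) (h : Fin k → EuclideanSpace ℝ (Fin 4) → EuclideanSpace ℝ (Fin 4)), 0 < a ∧ Metric.closedBall c (3 * a / 2) ⊆ Literature.Topology.FourManifolds.MMSW.modelHandlebody k ∧ IsOpen W ∧ {p : EuclideanSpace ℝ (Fin 4) | |p 0| ≤ 1 ∧ (p 1) ^ 2 + (p 2) ^ 2 + (p 3) ^ 2 ≤ 1} ⊆ W ∧ (∀ j, ContDiffOn ℝ ((⊤ : ℕ∞) : WithTop ℕ∞) (h j) W ∧ Set.InjOn (h j) W ∧ (∀ p ∈ W, Function.Injective (fderiv ℝ (h j) p)) ∧ Set.MapsTo (h j) W (Literature.Topology.FourManifolds.MMSW.modelHandlebody k)) ∧ (∀ j l, j ≠ l → ∀ p ∈ W, ∀ q ∈ W, h j p ≠ h l q) ∧ (∀ j, ∀ p ∈ W, 1 / 2 ≤ |p 0| → dist (h j p) c = a * (2 - |p 0|)) ∧ (∀ j,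 ∀ p ∈ W, |p 0| ≤ 1 / 2 → 3 * a / 2 ≤ dist (h j p) c) ∧ ∀ (U : Set (EuclideanSpace ℝ (Fin 4))) (m : Fin k → ℤ) (ρ : ℝ), IsOpen U → Literature.Topology.FourManifolds.MMSW.modelHandlebody k ⊆ U → a < ρ → ρ < 3 * a / 2 → ∃ (ε : Fin k → ℤ) (κ : EuclideanSpace ℝ (Fin 4) ≃ₘ⟮𝓡 4, 𝓡 4⟯ EuclideanSpace ℝ (Fin 4)) (K : Set (EuclideanSpace ℝ (Fin 4))) (θ : EuclideanSpace ℝ (Fin 4) → EuclideanSpace ℝ (Fin 4)), IsCompact K ∧ K ⊆ U ∧ (∀ x, x ∉ K → κ x = x) ∧ ContDiff ℝ ((⊤ : ℕ∞) : WithTop ℕ∞) θ ∧ Function.Injective θ ∧ (∀ x, Function.Injective (fderiv ℝ θ x)) ∧ ∀ x ∈ Literature.Topology.FourManifolds.MMSW.modelHandlebody k, (κ x ∈ Metric.closedBall c ρ ∧ θ (Literature.Topology.FourManifolds.MMSW.fibreRot (fun z : ℂ => ∏ l : Fin k, ((z - Literature.Topology.FourManifolds.MMSW.holeCentre k l) /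 (((‖z - Literature.Topology.FourManifolds.MMSW.holeCentre k l‖ : ℝ)) : ℂ)) ^ (ε l)) x) = κ x) ∨ (∃ j, ∃ p ∈ {p : EuclideanSpace ℝ (Fin 4) | |p 0| ≤ 1 ∧ (p 1) ^ 2 + (p 2) ^ 2 + (p 3) ^ 2 ≤ 1}, κ x = h j p ∧ θ (Literature.Topology.FourManifolds.MMSW.fibreRot (fun z : ℂ => ∏ l : Fin k, ((z - Literature.Topology.FourManifolds.MMSW.holeCentre k l) / (((‖z - Literature.Topology.FourManifolds.MMSW.holeCentre k l‖ : ℝ)) : ℂ)) ^ (ε l)) x) = h j (!₂[p 0, p 1, Real.cos (2 * Real.pi * (m j : ℝ) * Real.smoothTransition (p 0 + 1 / 2)) * p 2 - Real.sin (2 * Real.pi * (m j : ℝ) * Real.smoothTransition (p 0 + 1 / 2)) * p 3, Real.sin (2 * Real.pi * (m j : ℝ) * Real.smoothTransition (p 0 + 1 / 2)) * p 2 + Real.cos (2 * Real.pi * (m j : ℝ) * Real.smoothTransition (p 0 + 1 / 2)) * p 3])) :=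
  helper_handlebodyChart_modelHandles_of_data helper_handlebodyChart_modelHandles_data

/-- **Stub D of line `mk_friends` — handlebody germ charts are standard up to sector** (registered stub
`stub_handlebodyChart`, proved): in a compact simply connected smooth `4`-manifold every germ chart of `D_k`
extends, after a per-handle sphere twist `τ^ε`, to a global smooth embedding `e : ℝ⁴ → X` with `e ∘ τ^ε = i`
on `D_k`.  Assembly of the landed reduction `helper_handlebodyChart_of_facts2` with the discharged facts M1, M2
(`OneHandleUniquenessProofs.lean`) and M3 above. [cite: HirschDT1976, Ch. 4 §5 Thm. 5.3 and Ch. 8 §1 Thm. 1.3]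
[cite: GompfStipsicz1999, §4.4 and §5.4] [cite: Palais1960, Thm. B] -/
theorem stub_handlebodyChart : ∀ (k : ℕ) (X : Type) [TopologicalSpace X] [T2Space X] [SecondCountableTopology X] [ChartedSpace (EuclideanSpace ℝ (Fin 4)) X] [IsManifold (𝓡 4) ((⊤ : ℕ∞) : WithTop ℕ∞) X] [CompactSpace X], SimplyConnectedSpace X → ∀ (U : Set (EuclideanSpace ℝ (Fin 4))) (i : EuclideanSpace ℝ (Fin 4) → X), (IsOpen U ∧ Literature.Topology.FourManifolds.MMSW.modelHandlebody k ⊆ U ∧ ContMDiffOn (𝓡 4) (𝓡 4) ((⊤ : ℕ∞) : WithTop ℕ∞) i U ∧ Set.InjOn i U ∧ (∀ x ∈ U, Function.Injective (mfderiv (𝓡 4) (𝓡 4) i x))) → ∃ (ε : Fin k → ℤ) (e : EuclideanSpace ℝ (Fin 4) → X), Manifold.IsSmoothEmbedding (𝓡 4) (𝓡 4) ((⊤ : ℕ∞) : WithTop ℕ∞) e ∧ ∀ x ∈ Literature.Topology.FourManifolds.MMSW.modelHandlebody k, e (Literature.Topology.FourManifolds.MMSW.fibreRot (fun z : ℂ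 => ∏ j : Fin k, ((z - Literature.Topology.FourManifolds.MMSW.holeCentre k j) / (((‖z - Literature.Topology.FourManifolds.MMSW.holeCentre k j‖ : ℝ)) : ℂ)) ^ (ε j)) x) = i x :=
  helper_handlebodyChart_of_facts2 Literature.Topology.FourManifolds.oneHandle_ambientIsotopic_upToTwist_holds
    Literature.Topology.FourManifolds.arcs_ambientIsotopic_rel_of_homotopicRel_holds
    helper_handlebodyChart_modelHandles

end Summit.SmoothPoincare4.SmoothPoincare4.Theorems.DcrGap.MkFriends

end
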